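import Summits.BirchSwinnertonDyer.Rank1Residual.Additive.LocIrrValuationCriterionThree
import Summits.BirchSwinnertonDyer.Rank1Residual.Additive.PsiThreeNewtonPolygon
import Literature.NumberTheory.EllipticCurves.ModThreeReducibleIffPsi3Root
import Literature.NumberTheory.EllipticCurves.OpenImageMazurAssemblyProofs
import HarnessLib

/-!
# L-O56-sel PROVED: `LocIrr W 3 ↔ LocIrrCriterionThree W` for every elliptic curve over `ℚ`
# (cell `b2b-bsdres`, harvest seat 2, GEN 42, note E89; theorems only)

HONEST FRAMING (cell `b2b-bsdres`, run/shared/lean/b2b/bsd-rank1-residual/, verbatim in every file): the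
goal of the cell is to DELETE the COMBINATION-SHAPED residual classes of the Birch–Swinnerton-Dyer formula
for ALL analytic-rank `≤ 1` elliptic curves over `ℚ` — "full BSD formula for every rank `≤ 1` curve in
class `C`" assembled STRICTLY from published theorems — so that the rank-`≤ 1` remainder becomes exactly
the CONSTRUCTION-SHAPED classes, which are TYPED (missing-input `Prop`s), NOT attempted. This is not
"finishing BSD". This file: THEOREMS ONLY (no definition, no named fact, no `@[conjecture]` node; net
named-fact debt `0`); nothing about any particular curve is asserted; nothing is booked; no mark of
`RESIDUAL-MAP.md` moves.

## What is proved

cc-typer-5 GEN 3's TARGET **L-O56-sel `Additive.LocIrrThreeIffCriterion`**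
(`Additive/LocIrrValuationCriterionThree.lean`; EVIDENCE 36 323 O5b + 9 744 O5a + 296 O6-dicyclic rows, 0
exceptions, kit j124555 / j125222): for EVERY elliptic curve `W/ℚ`,
`LocIrr W 3 ↔ LocIrrCriterionThree W`, i.e. `E[3]|G_{ℚ₃}` is irreducible iff
`c₄ ≠ 0 ∧ (c₆ = 0 ∨ 3·v₃(c₄) + 2 ≤ 2·v₃(c₆))` — by exactly the route of that file's docstring:

1. `LocIrr W 3 ↔ Ψ₃` has no root in `ℚ₃` (the published dictionary, Cremona 1997 §3.8 / Silverman AEC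
   III.4.12, Rem. III.4.13.2, Ex. 3.7, tree theorem
   `WeierstrassCurve.hasIrreducibleModPGaloisRep_three_iff_forall_not_isRoot_Ψ₃` over any field of
   characteristic `0`, here `ℚ₃`);
2. both sides are invariant under a change of Weierstrass model (`locIrrCriterionThree_smul_iff`,
   PROVED in the target's file; `Mazur1978.hasIrreducibleModPGaloisRep_smul_iff` + Mathlib's
   `map_variableChange` for `LocIrr`, here `locIrr_three_smul_iff`), so we may take the short model
   `y² = x³ + Ax + B` (`W.toShortNF • W`), where `c₄ = −48A`, `c₆ = −864B`, `Ψ₃ = 3x⁴ + 6Ax² + 12Bx − A²`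
   and the criterion reads `A ≠ 0 ∧ (B = 0 ∨ 3·v₃(A) ≤ 2·v₃(B) + 1)`;
3. the `3`-adic Newton polygon of that quartic (`Additive/PsiThreeNewtonPolygon.lean`: no root under the
   criterion by the ultrametric inequality; a root off it by Hensel's lemma; `x = 0` when `A = 0`).

Consequences made UNCONDITIONAL (the `h : LocIrrThreeIffCriterion` binder of the target file's §3
corollaries discharged): `not_locIrr_three_of_c₄_eq_zero'`, `locIrr_three_of_c₆_eq_zero'`,
`locIrr_three_of_le'`, `not_locIrr_three_of_lt'`, `locIrr_three_iff_of_twist'`,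
`three_dvd_padicValInt_minimalDiscriminantInt_of_locIrr'` (gen 2's L-O6-irr first conjunct: `LocIrr W 3
⟹ 3 ∣ v₃(Δ_min)`). Not here: `SelectorIdentityTameThree` (needs the Kodaira III/III* rows of the
Halberstadt–Rizzo table as tree theorems on `ClassO5 ∧ SubTprime`; separate item).

References: [Cremona1997] §3.8; [SilvermanAEC2009] III.1, III.4.12, Remark III.4.13.2, Exercise 3.7;
J. Neukirch, *Algebraic Number Theory* II §6 [folklore]; cell notes `HOME/b2b-bsdres-harvest-2/gen42/`,
`cells/o5o6/TARGETS.md` §O6 (G3-10), `class-closure/O6/TYPED.md` §7.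
-/

set_option autoImplicit false

noncomputable section

open scoped Classical

open Polynomial WeierstrassCurve Literature.NumberTheory.EllipticCurves
  Summit.BirchSwinnertonDyer.Rank1Residual.Additive.PsiThreeAdic

namespace Summit.BirchSwinnertonDyer.Rank1Residual.Additive

/-! ## §1 `LocIrr` is a property of the curve, not of the model -/

/-- **Model independence of `LocIrr(3)`**: a change of Weierstrass model over `ℚ` induces one over `ℚ₃`,
under which irreducibility of `E[3]|G_{ℚ₃}` is invariant (`Mazur1978.hasIrreducibleModPGaloisRep_smul_iff`).
[folklore] -/
theorem locIrr_three_smul_iff (W : WeierstrassCurve ℚ) (C : VariableChange ℚ) :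
    LocIrr (C • W) 3 ↔ LocIrr W 3 := by
  unfold LocIrr
  rw [WeierstrassCurve.baseChange, WeierstrassCurve.baseChange, ← map_variableChange]
  exact Mazur1978.hasIrreducibleModPGaloisRep_smul_iff _ _ 3

/-! ## §2 The short model: `c₄ = −48A`, `c₆ = −864B`, `Ψ₃ = 3x⁴ + 6Ax² + 12Bx − A²` -/

section ShortNF

variable (S : WeierstrassCurve ℚ) [S.IsShortNF]

/-- `Ψ₃` of a short model `y² = x³ + Ax + B` over `ℚ₃`: `3x⁴ + 6Ax² + 12Bx − A²`. [cite: Cremona1997, §3.8] -/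
theorem eval_Ψ₃_baseChange_of_isShortNF (x : ℚ_[3]) :
    ((S.baseChange ℚ_[3]).Ψ₃).eval x =
      3 * x ^ 4 + 6 * (S.a₄ : ℚ_[3]) * x ^ 2 + 12 * (S.a₆ : ℚ_[3]) * x - (S.a₄ : ℚ_[3]) ^ 2 := by
  simp only [WeierstrassCurve.baseChange, Ψ₃, b₂, b₄, b₆, b₈, map_a₁, map_a₂, map_a₃, map_a₄, map_a₆,
    S.a₁_of_isShortNF, S.a₂_of_isShortNF, S.a₃_of_isShortNF, map_zero, eq_ratCast, eval_add, eval_mul,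
    eval_pow, eval_C, eval_X, eval_ofNat]
  ring

/-- `v₃(−48) = 1`. [folklore] -/
private theorem padicValRat_neg48 : padicValRat 3 (-48 : ℚ) = 1 := by
  rw [padicValRat.neg, show (48 : ℚ) = 3 * 16 by norm_num, padicValRat.mul (by norm_num) (by norm_num)]
  have h3 : padicValRat 3 (3 : ℚ) = 1 := by
    have := padicValRat.self (p := 3) (by norm_num); simpa using this
  have h16 : padicValRat 3 (16 : ℚ) = 0 := by
    have : (16 : ℚ) = ((16 : ℕ) : ℚ) := by norm_num
    rw [this, padicValRat.of_nat]; simp only [Nat.cast_eq_zero]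
    exact padicValNat.eq_zero_of_not_dvd (by norm_num)
  rw [h3, h16]; norm_num

/-- `v₃(−864) = 3`. [folklore] -/
private theorem padicValRat_neg864 : padicValRat 3 (-864 : ℚ) = 3 := by
  rw [padicValRat.neg, show (864 : ℚ) = (3 : ℚ) ^ 3 * 32 by norm_num,
    padicValRat.mul (by norm_num) (by norm_num), padicValRat.pow (3 : ℚ)]
  have h3 : padicValRat 3 (3 : ℚ) = 1 := by
    have := padicValRat.self (p := 3) (by norm_num); simpa using this
  have h32 : padicValRat 3 (32 : ℚ) = 0 := by
    have : (32 : ℚ) = ((32 : ℕ) : ℚ) := by norm_num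
    rw [this, padicValRat.of_nat]; simp only [Nat.cast_eq_zero]
    exact padicValNat.eq_zero_of_not_dvd (by norm_num)
  rw [h3, h32]; norm_num

/-- **The criterion on a short model** `y² = x³ + Ax + B`:
`LocIrrCriterionThree ⟺ A ≠ 0 ∧ (B = 0 ∨ 3·v₃(A) ≤ 2·v₃(B) + 1)` (`c₄ = −48A`, `c₆ = −864B`,
`v₃(48) = 1`, `v₃(864) = 3`). [folklore] -/
theorem locIrrCriterionThree_iff_of_isShortNF :
    LocIrrCriterionThree S ↔ S.a₄ ≠ 0 ∧ (S.a₆ = 0 ∨ 3 * padicValRat 3 S.a₄ ≤ 2 * padicValRat 3 S.a₆ + 1) := by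
  unfold LocIrrCriterionThree
  rw [S.c₄_of_isShortNF, S.c₆_of_isShortNF]
  simp only [ne_eq, mul_eq_zero, show ¬ ((-48 : ℚ) = 0) by norm_num,
    show ¬ ((-864 : ℚ) = 0) by norm_num, false_or]
  by_cases hA : S.a₄ = 0
  · simp [hA]
  by_cases hB : S.a₆ = 0
  · simp [hA, hB]
  simp only [hA, hB, not_false_eq_true, true_and, false_or]
  rw [padicValRat.mul (by norm_num) hA, padicValRat.mul (by norm_num) hB, padicValRat_neg48,
    padicValRat_neg864]
  omega

/-- **L-O56-sel on a short model.** [folklore] -/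
theorem locIrr_three_iff_criterion_of_isShortNF [S.IsElliptic] : LocIrr S 3 ↔ LocIrrCriterionThree S := by
  rw [locIrrCriterionThree_iff_of_isShortNF]
  unfold LocIrr
  rw [(S.baseChange ℚ_[3]).hasIrreducibleModPGaloisRep_three_iff_forall_not_isRoot_Ψ₃]
  simp only [IsRoot.def, eval_Ψ₃_baseChange_of_isShortNF]
  constructor
  · intro h
    by_contra hneg
    by_cases hA : S.a₄ = 0
    · apply h 0
      rw [hA]; push_cast; ring
    · have hneg' : ¬ (S.a₆ = 0 ∨ 3 * padicValRat 3 S.a₄ ≤ 2 * padicValRat 3 S.a₆ + 1) :=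
        fun h' ↦ hneg ⟨hA, h'⟩
      push Not at hneg'
      obtain ⟨x, hx⟩ := psi3_exists_root_of_lt hA hneg'.1 (by omega)
      exact h x hx
  · rintro ⟨hA, hcrit⟩ x
    exact psi3_ne_zero_of_criterion hA hcrit x

end ShortNF

/-! ## §3 L-O56-sel for every elliptic curve over `ℚ` -/

/-- **`LocIrr W 3 ↔ LocIrrCriterionThree W`** for every elliptic curve over `ℚ` (any Weierstrass model):
reduce to the short model `W.toShortNF • W` by model independence of both sides.
[cite: Cremona1997, §3.8 (l = 3)] [cite: SilvermanAEC2009, III.1, III.4.12, Remark III.4.13.2 and Exercise 3.7] -/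
theorem locIrr_three_iff_locIrrCriterionThree (W : WeierstrassCurve ℚ) [W.IsElliptic] :
    LocIrr W 3 ↔ LocIrrCriterionThree W := by
  rw [← locIrr_three_smul_iff W W.toShortNF, ← locIrrCriterionThree_smul_iff W W.toShortNF]
  exact locIrr_three_iff_criterion_of_isShortNF (W.toShortNF • W)

/-- **L-O56-sel `LocIrrThreeIffCriterion` HOLDS.** [cite: Cremona1997, §3.8 (l = 3)]
[cite: SilvermanAEC2009, III.1, III.4.12, Remark III.4.13.2 and Exercise 3.7] -/
theorem locIrrThreeIffCriterion_holds : LocIrrThreeIffCriterion := by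
  intro W _ _
  exact locIrr_three_iff_locIrrCriterionThree W

/-! ## §4 The target file's corollaries, now unconditional -/

section Corollaries

variable (W : WeierstrassCurve ℚ) [W.IsElliptic] [W.IsGloballyMinimal]

/-- `j = 0` (`c₄ = 0`) ⇒ `E[3]|G_{ℚ₃}` reducible. [folklore] -/
theorem not_locIrr_three_of_c₄_eq_zero' (hc : W.c₄ = 0) : ¬ LocIrr W 3 :=
  not_locIrr_three_of_c₄_eq_zero W locIrrThreeIffCriterion_holds hc

/-- `j = 1728` (`c₆ = 0 ≠ c₄`) ⇒ `E[3]|G_{ℚ₃}` irreducible. [folklore] -/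
theorem locIrr_three_of_c₆_eq_zero' (hc4 : W.c₄ ≠ 0) (hc6 : W.c₆ = 0) : LocIrr W 3 :=
  locIrr_three_of_c₆_eq_zero W locIrrThreeIffCriterion_holds hc4 hc6

/-- `c₄ ≠ 0 ∧ 3·v₃(c₄) + 2 ≤ 2·v₃(c₆) ⇒ LocIrr W 3`. [folklore] -/
theorem locIrr_three_of_le' (hc4 : W.c₄ ≠ 0)
    (hle : 3 * padicValRat 3 W.c₄ + 2 ≤ 2 * padicValRat 3 W.c₆) : LocIrr W 3 :=
  locIrr_three_of_le W locIrrThreeIffCriterion_holds hc4 hle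

/-- `c₆ ≠ 0 ∧ 2·v₃(c₆) ≤ 3·v₃(c₄) + 1 ⇒ ¬ LocIrr W 3` (every cyclic wild row, every multiplicative /
good ordinary row, the generic III `(≥2,3,3)` / III* `(≥4,6,9)` rows). [folklore] -/
theorem not_locIrr_three_of_lt' (hc6 : W.c₆ ≠ 0)
    (hlt : 2 * padicValRat 3 W.c₆ ≤ 3 * padicValRat 3 W.c₄ + 1) : ¬ LocIrr W 3 :=
  not_locIrr_three_of_lt W locIrrThreeIffCriterion_holds hc6 hlt

/-- `LocIrr(3)` is quadratic-twist invariant (twists presented by globally minimal models). [folklore] -/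
theorem locIrr_three_iff_of_twist' {d : ℚ} (hd : d ≠ 0)
    (Wd : WeierstrassCurve ℚ) [Wd.IsElliptic] [Wd.IsGloballyMinimal] (C : VariableChange ℚ)
    (hWd : C • W.quadraticTwist d = Wd) : LocIrr Wd 3 ↔ LocIrr W 3 :=
  locIrr_three_iff_of_twist W locIrrThreeIffCriterion_holds hd Wd C hWd

/-- **`LocIrr W 3 ⇒ 3 ∣ v₃(Δ_min)`** — the first conjunct of gen 2's L-O6-irr
(`MinimalDiscIsCubeUnramifiedThree`), now a theorem. [folklore] -/
theorem three_dvd_padicValInt_minimalDiscriminantInt_of_locIrr' (hL : LocIrr W 3) :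
    (3 : ℤ) ∣ (padicValInt 3 W.minimalDiscriminantInt : ℤ) :=
  three_dvd_padicValInt_minimalDiscriminantInt_of_locIrr W locIrrThreeIffCriterion_holds hL

end Corollaries

end Summit.BirchSwinnertonDyer.Rank1Residual.Additive
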